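import Literature.Probability.Percolation.CLE6RerootSaturated
import Literature.Probability.Percolation.SiteInterfaceStructure
import HarnessLib

/-!
# Connected subsets of a simple hexagonal polygon are covered by a stretch of consecutive edges

Topic: Probability / Percolation.  Lattice-side bookkeeping for "a connected piece of a cluster
interface is a sub-arc of the interface loop" (F. Camia, C. M. Newman, Comm. Math. Phys. 268
(2006), §4: cluster boundaries of site percolation on `𝕋` are *simple* loops of the hexagonal
lattice, so connected subsets of their traces are arcs), for the polygon `polyTrace δ w` of a
cycle `w` of `hexGraph` (`TriExplorationPolygon.lean`) and its rotations `w.rotateAt k`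
(`CLE6RerootSaturated.lean`):

* `polyPiece_inter_polyPiece_of_isCycle` — **two dart pieces of a cycle meet only if they are
  cyclically adjacent** (closed edges of the hexagonal lattice meet only at common endpoints,
  `hexEdge_inter`; the faces of a cycle are distinct);
* `exists_Icc_of_isPreconnected_subset_polyTrace` — a nonempty preconnected subset of the trace
  missing the last piece meets exactly the pieces of an interval of indices `a ≤ j ≤ b`,
  `b + 1 < n` (otherwise the pieces before and after a missed index give a separation by two
  closed sets);
* `getVert_rotateAt_mod`, `polyPiece_rotateAt` — rotating the walk at position `k` shifts the
  indices of the pieces by `k` (and keeps the trace, `polyTrace_rotateAt` of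
  `AltFourArmOfCrossingLoops.lean`, reproved privately here from the darts);
* `exists_rotateAt_Icc_of_isPreconnected` — **every nonempty preconnected subset of the trace of
  a cycle is covered by, and meets every piece of, a stretch `a ≤ j ≤ b < n` of consecutive
  pieces of a rotation `w.rotateAt k`** (`0 < k ≤ n`; rotate so that a missed piece, if any,
  comes last);
* `getElem_loopPts`, `segment_loopPts_eq_polyPiece` — the pieces are the edges of the closed
  polygon through `loopPts δ w` (the vertex list entering `siteLoopCurve_eq_closedPolygon`).

## References

* F. Camia, C. M. Newman, Comm. Math. Phys. 268 (2006), §4. [CamiaNewman2006]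
* M. Aizenman, A. Burchard, Duke Math. J. 99 (1999), §2.1 (curves modulo reparametrisation).
-/

noncomputable section

open Set Metric

namespace Literature.Probability.Percolation

open LatticeModels RandomPlanarGeometry

variable {f₀ : HexVertex} {w : hexGraph.Walk f₀ f₀}

/-! ### Pieces of a cycle meet only when cyclically adjacent -/

/-- Equal vertices of a cycle have equal indices, apart from the identification of the two
ends `v_0 = v_n`. [folklore] -/
theorem getVert_eq_getVert_of_isCycle (hw : w.IsCycle) {p q : ℕ} (hp : p ≤ w.length) (hq : q ≤ w.length)
    (h : w.getVert p = w.getVert q) : p = q ∨ (p = 0 ∧ q = w.length) ∨ (p = w.length ∧ q = 0) := by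
  by_cases hp0 : p = 0
  · subst hp0
    rw [SimpleGraph.Walk.getVert_zero, eq_comm, hw.getVert_endpoint_iff hq] at h
    omega
  by_cases hq0 : q = 0
  · subst hq0
    rw [SimpleGraph.Walk.getVert_zero, hw.getVert_endpoint_iff hp] at h
    omega
  left
  exact hw.getVert_injOn (by simp only [Set.mem_setOf_eq]; omega) (by simp only [Set.mem_setOf_eq]; omega) h

/-- **Two dart pieces of the polygon of a cycle of the hexagonal lattice meet only if they are
cyclically adjacent**: for `i < j < n`, a common point of the `i`-th and the `j`-th piece forces
`j = i + 1` or `(i, j) = (0, n - 1)` (two closed edges of `H` meet only at a common endpoint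
unless they coincide, `hexEdge_inter`, and the faces `v_0, …, v_{n-1}` of a cycle are distinct)
(Camia–Newman 2006, §4: interface loops are simple). [cite: CamiaNewman2006, §4] -/
theorem polyPiece_inter_polyPiece_of_isCycle (hw : w.IsCycle) {δ : ℝ} (hδ : δ ≠ 0) {i j : ℕ}
    (hij : i < j) (hj : j < w.length) {z : ℂ} (hzi : z ∈ polyPiece δ w i) (hzj : z ∈ polyPiece δ w j) :
    j = i + 1 ∨ (i = 0 ∧ j + 1 = w.length) := by
  have hi : i < w.length := hij.trans hj
  obtain ⟨a, ha⟩ := exists_oppFace_eq_of_hexGraph_adj (w.adj_getVert_succ hi)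
  obtain ⟨b, hb⟩ := exists_oppFace_eq_of_hexGraph_adj (w.adj_getVert_succ hj)
  rw [polyPiece, polyPt, polyPt, mem_segment_mul_iff hδ, ha] at hzi
  rw [polyPiece, polyPt, polyPt, mem_segment_mul_iff hδ, hb] at hzj
  have key : ∀ {p q : ℕ}, p ≤ w.length → q ≤ w.length → w.getVert p = w.getVert q →
      p = q ∨ (p = 0 ∧ q = w.length) ∨ (p = w.length ∧ q = 0) :=
    fun hp hq h ↦ getVert_eq_getVert_of_isCycle hw hp hq h
  have hc : ∀ {F G : HexVertex}, (δ⁻¹ : ℝ) • z = hexCenter F → (δ⁻¹ : ℝ) • z = hexCenter G → F = G :=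
    fun h h' ↦ hexCenter_injective (h.symm.trans h')
  rcases hexEdge_inter hzi hzj with ⟨h1, h2⟩ | ⟨h1, -⟩ | ⟨-, h2⟩
  · rcases h1 with h1 | h1 <;> rcases h2 with h2 | h2
    · have := key hi.le hj.le (hc h1 h2); omega
    · rw [← hb] at h2
      have := key hi.le (by omega) (hc h1 h2); omega
    · rw [← ha] at h1
      have := key (by omega) hj.le (hc h1 h2); omega
    · rw [← ha] at h1; rw [← hb] at h2
      have := key (by omega) (by omega) (hc h1 h2); omega
  · have := key hi.le hj.le h1; omega
  · rw [← ha] at h2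
    have := key (by omega) hj.le h2; omega

/-- Dart pieces are closed segments. [folklore] -/
theorem isClosed_polyPiece (δ : ℝ) (w : hexGraph.Walk f₀ f₀) (i : ℕ) : IsClosed (polyPiece δ w i) := by
  rw [polyPiece, ← Path.range_segment]
  exact (isCompact_range (Path.segment _ _).continuous).isClosed

/-! ### A connected subset of the trace meets an interval of pieces -/

/-- **A preconnected subset of the trace missing the last piece meets an interval of pieces.**
For a cycle `w` of length `n`, a nonempty preconnected `C ⊆ polyTrace δ w` disjoint from the
piece `n - 1` is covered by the pieces `a, …, b` for some `a ≤ b`, `b + 1 < n`, and meets each of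
them: if it missed a piece `a < j < b`, the (closed) unions of the pieces `< j` and of the pieces
strictly between `j` and `n - 1` would separate it, non-adjacent pieces being disjoint.
[cite: CamiaNewman2006, §4] -/
theorem exists_Icc_of_isPreconnected_subset_polyTrace (hw : w.IsCycle) {δ : ℝ} (hδ : δ ≠ 0)
    {C : Set ℂ} (hC : IsPreconnected C) (hCsub : C ⊆ polyTrace δ w) (hCne : C.Nonempty)
    (hlast : Disjoint C (polyPiece δ w (w.length - 1))) :
    ∃ a b : ℕ, a ≤ b ∧ b + 1 < w.length ∧ (C ⊆ ⋃ j ∈ Icc a b, polyPiece δ w j) ∧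
      ∀ j ∈ Icc a b, (C ∩ polyPiece δ w j).Nonempty := by
  classical
  set J : Finset ℕ := (Finset.range w.length).filter (fun j ↦ (C ∩ polyPiece δ w j).Nonempty) with hJ
  have hJmem : ∀ j, j ∈ J ↔ j < w.length ∧ (C ∩ polyPiece δ w j).Nonempty := by
    intro j; simp [hJ]
  have hJne : J.Nonempty := by
    obtain ⟨z, hz⟩ := hCne
    obtain ⟨j, hj, hzj⟩ := mem_polyTrace_iff.1 (hCsub hz)
    exact ⟨j, (hJmem j).2 ⟨hj, z, hz, hzj⟩⟩
  have hlastJ : w.length - 1 ∉ J := fun h ↦ by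
    obtain ⟨z, hzC, hz⟩ := ((hJmem _).1 h).2
    exact Set.disjoint_left.1 hlast hzC hz
  set a := J.min' hJne with ha
  set b := J.max' hJne with hb
  have haJ : a ∈ J := J.min'_mem hJne
  have hbJ : b ∈ J := J.max'_mem hJne
  have hbn : b + 1 < w.length := by
    have h1 := ((hJmem b).1 hbJ).1
    rcases (show b + 1 < w.length ∨ b = w.length - 1 by omega) with h | h
    · exact h
    · exact absurd (h ▸ hbJ) hlastJ
  refine ⟨a, b, J.min'_le _ hbJ, hbn, fun z hz ↦ ?_, fun j hj ↦ ?_⟩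
  · obtain ⟨i, hi, hzi⟩ := mem_polyTrace_iff.1 (hCsub hz)
    have hiJ : i ∈ J := (hJmem i).2 ⟨hi, z, hz, hzi⟩
    exact mem_iUnion₂.2 ⟨i, ⟨J.min'_le _ hiJ, J.le_max' _ hiJ⟩, hzi⟩
  · by_contra hempty
    have hjJ : j ∉ J := fun h ↦ hempty ((hJmem j).1 h).2
    have haj : a < j := lt_of_le_of_ne hj.1 fun h ↦ hjJ (h ▸ haJ)
    have hjb : j < b := lt_of_le_of_ne hj.2 fun h ↦ hjJ (h ▸ hbJ)
    -- the pieces before `j` and the pieces strictly between `j` and `n - 1`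
    set U : Set ℂ := ⋃ i ∈ Iio j, polyPiece δ w i with hU
    set V : Set ℂ := ⋃ i ∈ Ioo j (w.length - 1), polyPiece δ w i with hV
    have hUc : IsClosed U := (finite_Iio j).isClosed_biUnion fun i _ ↦ isClosed_polyPiece δ w i
    have hVc : IsClosed V := (finite_Ioo j _).isClosed_biUnion fun i _ ↦ isClosed_polyPiece δ w i
    have hcover : C ⊆ U ∪ V := fun z hz ↦ by
      obtain ⟨i, hi, hzi⟩ := mem_polyTrace_iff.1 (hCsub hz)
      have hiJ : i ∈ J := (hJmem i).2 ⟨hi, z, hz, hzi⟩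
      have hij : i ≠ j := fun h ↦ hjJ (h ▸ hiJ)
      have hil : i ≠ w.length - 1 := fun h ↦ hlastJ (h ▸ hiJ)
      rcases lt_or_gt_of_ne hij with h | h
      · exact Or.inl (mem_iUnion₂.2 ⟨i, h, hzi⟩)
      · exact Or.inr (mem_iUnion₂.2 ⟨i, ⟨h, by omega⟩, hzi⟩)
    have hCU : (C ∩ U).Nonempty := by
      obtain ⟨z, hzC, hza⟩ := ((hJmem a).1 haJ).2
      exact ⟨z, hzC, mem_iUnion₂.2 ⟨a, haj, hza⟩⟩
    have hCV : (C ∩ V).Nonempty := by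
      obtain ⟨z, hzC, hzb⟩ := ((hJmem b).1 hbJ).2
      exact ⟨z, hzC, mem_iUnion₂.2 ⟨b, ⟨hjb, by omega⟩, hzb⟩⟩
    obtain ⟨z, -, hzU, hzV⟩ := isPreconnected_closed_iff.1 hC U V hUc hVc hcover hCU hCV
    obtain ⟨i, hi, hzi⟩ := mem_iUnion₂.1 hzU
    obtain ⟨i', hi', hzi'⟩ := mem_iUnion₂.1 hzV
    have hii' : i < i' := lt_trans (mem_Iio.1 hi) hi'.1
    have := polyPiece_inter_polyPiece_of_isCycle hw hδ hii' (by have := hi'.2; omega) hzi hzi'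
    have := mem_Iio.1 hi
    have := hi'.1
    have := hi'.2
    omega

/-! ### Rotations shift the pieces -/

/-- **Vertices of the rotated walk**: for `k ≤ n` and `j < n`, the `j`-th and `(j+1)`-st faces
of `w.rotateAt k` are the faces `(j + k) % n` and `(j + k) % n + 1` of `w` (the darts are rotated
by `k`, `darts_rotateAt`). [folklore] -/
theorem getVert_rotateAt_mod {k : ℕ} (hk : k ≤ w.length) {j : ℕ} (hj : j < w.length) :
    (w.rotateAt k).getVert j = w.getVert ((j + k) % w.length) ∧
      (w.rotateAt k).getVert (j + 1) = w.getVert ((j + k) % w.length + 1) := by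
  have hn : 0 < w.length := by omega
  have hlen := SimpleGraph.Walk.length_rotateAt w hk
  have hj' : j < (w.rotateAt k).darts.length := by
    rw [SimpleGraph.Walk.length_darts, hlen]; exact hj
  have hm : (j + k) % w.darts.length < w.darts.length :=
    Nat.mod_lt _ (by rw [SimpleGraph.Walk.length_darts]; exact hn)
  have hd : (w.rotateAt k).darts[j]'hj' = w.darts[(j + k) % w.darts.length]'hm := by
    rw [List.getElem_of_eq (SimpleGraph.Walk.darts_rotateAt w hk), List.getElem_rotate]
  rw [SimpleGraph.Walk.darts_getElem_eq_getVert j hj', SimpleGraph.Walk.darts_getElem_eq_getVert _ hm,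
    SimpleGraph.Dart.ext_iff, Prod.ext_iff] at hd
  simp only [SimpleGraph.Walk.length_darts] at hd
  exact ⟨hd.1, hd.2⟩

/-- **Pieces of the rotated walk**: `polyPiece δ (w.rotateAt k) j = polyPiece δ w ((j + k) % n)`
for `k ≤ n`, `j < n`. [folklore] -/
theorem polyPiece_rotateAt (δ : ℝ) {k : ℕ} (hk : k ≤ w.length) {j : ℕ} (hj : j < w.length) :
    polyPiece δ (w.rotateAt k) j = polyPiece δ w ((j + k) % w.length) := by
  obtain ⟨h1, h2⟩ := getVert_rotateAt_mod hk hj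
  rw [polyPiece, polyPiece, polyPt, polyPt, polyPt, polyPt, h1, h2]

/-- **The trace is invariant under rotation** (same darts); dart-based proof of the tree's
`polyTrace_rotateAt` (`AltFourArmOfCrossingLoops.lean`), kept private to avoid the import.
[folklore] -/
private theorem polyTrace_rotateAt' (δ : ℝ) {k : ℕ} (hk : k ≤ w.length) :
    polyTrace δ (w.rotateAt k) = polyTrace δ w := by
  ext z
  simp only [mem_polyTrace_iff_exists_dart, SimpleGraph.Walk.darts_rotateAt w hk, List.mem_rotate]

/-! ### Covering a connected subset of the trace by a stretch of a rotation -/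

/-- **A connected subset of a simple hexagonal polygon is covered by a stretch of consecutive
pieces.** For a cycle `w` of `hexGraph` of length `n`, `δ ≠ 0` and a nonempty preconnected
`C ⊆ polyTrace δ w`, there are a rotation position `0 < k ≤ n` and indices `a ≤ b < n` such
that `C` is covered by the pieces `a, …, b` of `w.rotateAt k` and meets each of them. (If every
piece meets `C` take `k = n`, all pieces; otherwise rotate a missed piece into the last position
and apply `exists_Icc_of_isPreconnected_subset_polyTrace`.) This is the lattice form of
"connected subsets of a simple loop are arcs" (Camia–Newman 2006, §4). [cite: CamiaNewman2006, §4] -/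
theorem exists_rotateAt_Icc_of_isPreconnected (hw : w.IsCycle) {δ : ℝ} (hδ : δ ≠ 0) {C : Set ℂ}
    (hC : IsPreconnected C) (hCsub : C ⊆ polyTrace δ w) (hCne : C.Nonempty) :
    ∃ k, 0 < k ∧ k ≤ w.length ∧ ∃ a b : ℕ, a ≤ b ∧ b < w.length ∧
      (C ⊆ ⋃ j ∈ Icc a b, polyPiece δ (w.rotateAt k) j) ∧
      ∀ j ∈ Icc a b, (C ∩ polyPiece δ (w.rotateAt k) j).Nonempty := by
  have hn : 0 < w.length := by have := hw.three_le_length; omega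
  by_cases hall : ∀ i < w.length, (C ∩ polyPiece δ w i).Nonempty
  · -- all pieces meet `C`: no rotation needed (`k = n`)
    have hpc : ∀ j < w.length, polyPiece δ (w.rotateAt w.length) j = polyPiece δ w j := fun j hj ↦ by
      rw [polyPiece_rotateAt δ le_rfl hj, Nat.add_mod_right, Nat.mod_eq_of_lt hj]
    refine ⟨w.length, hn, le_rfl, 0, w.length - 1, Nat.zero_le _, by omega, fun z hz ↦ ?_, fun j hj ↦ ?_⟩
    · obtain ⟨i, hi, hzi⟩ := mem_polyTrace_iff.1 (hCsub hz)
      exact mem_iUnion₂.2 ⟨i, ⟨Nat.zero_le _, by omega⟩, by rw [hpc i hi]; exact hzi⟩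
    · have hj' : j < w.length := by have := hj.2; omega
      rw [hpc j hj']
      exact hall j hj'
  · push Not at hall
    obtain ⟨i₀, hi₀, hempty⟩ := hall
    set k := i₀ + 1 with hk_def
    have hk : k ≤ w.length := hi₀
    have hw' : (w.rotateAt k).IsCycle := hw.rotateAt (Nat.succ_pos _) hk
    have hlen : (w.rotateAt k).length = w.length := SimpleGraph.Walk.length_rotateAt w hk
    have hlast : Disjoint C (polyPiece δ (w.rotateAt k) ((w.rotateAt k).length - 1)) := by
      rw [hlen, polyPiece_rotateAt δ hk (by omega), show w.length - 1 + k = i₀ + w.length by omega,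
        Nat.add_mod_right, Nat.mod_eq_of_lt hi₀]
      exact Set.disjoint_iff_inter_eq_empty.2 hempty
    obtain ⟨a, b, hab, hb, hcov, hmeet⟩ := exists_Icc_of_isPreconnected_subset_polyTrace hw' hδ hC
      (by rw [polyTrace_rotateAt' δ hk]; exact hCsub) hCne hlast
    exact ⟨k, Nat.succ_pos _, hk, a, b, hab, by rw [hlen] at hb; omega, hcov, hmeet⟩

/-! ### The pieces are the edges of the closed polygon through `loopPts` -/

/-- The `j`-th entry of `loopPts δ w` is the `j`-th polygon vertex. [folklore] -/
theorem getElem_loopPts (δ : ℝ) (w : hexGraph.Walk f₀ f₀) {j : ℕ} (hj : j < (loopPts δ w).length) :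
    (loopPts δ w)[j] = polyPt δ w j := by
  simp only [loopPts, List.getElem_map, List.getElem_dropLast, polyPt,
    SimpleGraph.Walk.support_getElem_eq_getVert]

/-- **The `j`-th edge of the closed polygon through `loopPts δ w` is the `j`-th dart piece**
(`j < n`; cyclic indices, the vertex after the last being the first). [folklore] -/
theorem segment_loopPts_eq_polyPiece (δ : ℝ) (w : hexGraph.Walk f₀ f₀) (hn : 0 < w.length) {j : ℕ}
    (hj : j < w.length) :
    segment ℝ ((loopPts δ w)[j % (loopPts δ w).length]'(Nat.mod_lt _ (by rwa [length_loopPts])))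
      ((loopPts δ w)[(j + 1) % (loopPts δ w).length]'(Nat.mod_lt _ (by rwa [length_loopPts]))) =
      polyPiece δ w j := by
  rw [getElem_loopPts, getElem_loopPts, polyPiece, length_loopPts, Nat.mod_eq_of_lt hj]
  congr 1
  rcases (show j + 1 < w.length ∨ j + 1 = w.length by omega) with h | h
  · rw [Nat.mod_eq_of_lt h]
  · rw [h, Nat.mod_self, polyPt, polyPt, SimpleGraph.Walk.getVert_zero, SimpleGraph.Walk.getVert_length]

end Literature.Probability.Percolation
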